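import Summits.CriticalPhenomena.SAWScalingLimit.Theorems.SAWDevelopingMapNoFoldBoundPeelFarPositivity

/-!
# Local terms of a Duminil-Copin–Smirnov row: rigid phase times mass, and neighbours in coordinates

Helper file for the crux `NoFoldBound` (stmt-CriticalPhenomena-8296) of the route `SAWDevelopingMap`
(sub-problem `SAWScalingLimit` of `CriticalPhenomena`), programme FLAT / PEELED LP of the lead seats
c9–c10 (`FLAT-LEAN-DESIGN.md` on the item, layer L3 generic bricks G1/G3). In a row of the peeled LP
(`Peel.sum_boundary_darts_observable_eq_zero` for `D = stripDom T L ∖ K` and a K-door `{p, q}`) every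
LOCAL exit dart `(y, w)` contributes

  `(mid{y,w} − c y) · F_s({y,w}) = (c q − c p)/2 · e^{i(3/8)W₀} · Σ_γ x^{ℓ(γ)}`

where `W₀` is the winding of any one witness walk `γ₀ : {p,q} → {y,w}` (termwise
`Peel.dart_term_eq`, then rigidity `HexMidEdgeSAW.winding_eq_of_mem_boundary` in the simply connected
`D`): the unknown of the LP is the real mass, its coefficient a pure phase. This file proves that
factorisation (`local_term_eq`) and the coordinate description of the neighbour finset used to expand
the local double sum (`nbrs_ofHV`).
-/

noncomputable section

open scoped BigOperators Classical
open Literature.Probability.LatticeModels Literature.Probability.RandomPlanarGeometry.SAW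
open Literature.Barriers.CriticalPhenomena.HexGreen (nbrs mem_nbrs_iff)

namespace Summit.CriticalPhenomena.SAWScalingLimit.Theorems.SAWDevelopingMapNoFoldBound.Peel

/-- **Local term = entrance coefficient × rigid phase × mass.** For a simply connected `D`, a door
`{p,q}` (`p ∉ D ∋ q`), an exit dart `(y, w)` (`y ∈ D ∌ w`) other than the door itself, and a witness
walk `γ₀`, the dart term of the DCS row factors through the real exit mass. -/
theorem local_term_eq : ∀ {D : Finset HexVertex} {p q y w : HexVertex}, hexDomainSimplyConnected D → p ∉ D → q ∈ D → hexGraph.Adj p q → y ∈ D → w ∉ D → hexGraph.Adj y w → s(p, q) ≠ s(y, w) → ∀ (γ₀ : HexMidEdgeSAW D s(p, q) s(y, w)) (x : ℝ), (hexMidpoint s(y, w) - hexCenter y) * hexParafermionicObservable D s(p, q) x (5 / 8) s(y, w) = (hexCenter q - hexCenter p) / 2 * (Complex.exp (Complex.I * (3 / 8 : ℝ) * (γ₀.winding : ℂ)) * ((∑ γ : HexMidEdgeSAW D s(p, q) s(y, w), x ^ γ.length : ℝ) : ℂ)) := by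
  intro D p q y w hD hp hq hpq hy hw hyw hne0 γ₀ x
  have hs : s(p, q) ∈ hexDomainBoundary D :=
    ⟨(SimpleGraph.mem_edgeSet hexGraph).2 hpq, p, q, rfl, hq, hp⟩
  have hm : s(y, w) ∈ hexDomainBoundary D :=
    ⟨(SimpleGraph.mem_edgeSet hexGraph).2 hyw, w, y, Sym2.eq_swap, hy, hw⟩
  rw [observable_eq_sum_weight, Finset.mul_sum, Complex.ofReal_sum, Finset.mul_sum, Finset.mul_sum]
  refine Finset.sum_congr rfl fun γ _ => ?_
  have hne : γ.verts ≠ [] := fun h => hne0 (γ.eq_of_nil h)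
  have hlast : γ.verts.getLast hne = y := by
    rcases γ.getLast_eq_or hne with h | h
    · exact h
    · have hmem := γ.subset _ (List.getLast_mem hne)
      rw [h] at hmem
      exact absurd hmem hw
  have ht : Complex.exp (-Complex.I * ((5 / 8 : ℝ) : ℂ) * (γ.winding : ℂ)) * (x : ℂ) ^ γ.length =
      γ.weight x (5 / 8) := rfl
  rw [ht, dart_term_eq γ hp hpq hyw hne hlast x,
    HexMidEdgeSAW.winding_eq_of_mem_boundary hD hs hm γ γ₀, Complex.ofReal_pow]

/-- The door dart itself: `(mid{q,p} − c q) · F_s({q,p}) = −(c q − c p)/2` (`F_s(s) = 1`). -/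
theorem door_dart_term_eq {D : Finset HexVertex} {p q : HexVertex} (hp : p ∉ D) (hq : q ∈ D)
    (hpq : hexGraph.Adj p q) (x σ : ℝ) :
    (hexMidpoint s(q, p) - hexCenter q) * hexParafermionicObservable D s(p, q) x σ s(q, p) =
      -((hexCenter q - hexCenter p) / 2) := by
  have hs : s(p, q) ∈ hexDomainBoundary D :=
    ⟨(SimpleGraph.mem_edgeSet hexGraph).2 hpq, p, q, rfl, hq, hp⟩
  rw [Sym2.eq_swap (a := q) (b := p), hexParafermionicObservable_self hs, mul_one, hexMidpoint_mk]
  ring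

/-- **Neighbours in coordinates**: the neighbour finset of an `ofHV`-image is the image of the
coordinate neighbour list. -/
theorem nbrs_ofHV (v : HV) : nbrs (ofHV v) = ((HV.nbrs v).map ofHV).toFinset := by
  ext f
  rw [mem_nbrs_iff, List.mem_toFinset, List.mem_map, hexGraph_adj_iff_hvGraph_adj, toHV_ofHV,
    hvGraph_adj_iff_mem_nbrs]
  constructor
  · intro h; exact ⟨toHV f, h, ofHV_toHV f⟩
  · rintro ⟨w, hw, rfl⟩; simpa using hw

end Summit.CriticalPhenomena.SAWScalingLimit.Theorems.SAWDevelopingMapNoFoldBound.Peel
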